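import Summits.Ventures.HodgeRepro.BallChainRule

/-!
# The Hecke-translate wedge on the 2-ball — the algebraic core (seat p5)

Blind re-derivation cell `pub-hodge-repro`, seat `p5` (second seat on statement (c)).  Built on the sealer's
`BallModel.lean` and on `BallChainRule.lean` (action laws, chain rule, the boosts `boost a` with
`act_boost_center` — `U(2,1)` is transitive on the ball — and the isotropy elements `swapU`, `phaseU`).
This file declares no definitions or instances: theorems only.

* `act_swapU_center`, `act_phaseU_center`, `Jac_swapU_center`, `Jac_phaseU_center` — the isotropy
  elements `swapU`, `phaseU` fix the centre, with Jacobians `[[0,1],[1,0]]`, `[[1,0],[0,i]]`;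
* `wedge_mulVec`, `wedge_eq_zero_of_wedge_eq_zero` — the 2×2 wedge algebra;
* `exists_wedge_ne_zero` — the **algebraic core of statement (c)**: for any cotangent fields `F, G` on
  `𝔹²` that are not identically zero, some `γ ∈ U(2,1)` and `z ∈ 𝔹²` have
  `wedge ((Jac γ z)ᵀ *ᵥ F (act γ z)) (G z) ≠ 0`.  (No continuity is used; the density step is separate.)
-/

set_option autoImplicit false

noncomputable section

namespace Summit.Ventures.HodgeRepro

namespace BallCore

open Matrix hiding J
open Complex hiding lift
open ComplexConjugate BallModel

/-! ### The isotropy elements at the centre: fixed point and Jacobians -/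

/-- The swap fixes the centre. -/
theorem act_swapU_center : act swapU center = center := by
  apply Subtype.ext
  ext i
  fin_cases i <;>
    simp [act, proj, W3, swapU, swapMat, lift_center, center_val, Matrix.mulVec, dotProduct,
      Fin.sum_univ_three]

/-- The phase fixes the centre. -/
theorem act_phaseU_center : act phaseU center = center := by
  apply Subtype.ext
  ext i
  fin_cases i <;>
    simp [act, proj, W3, phaseU, phaseMat, lift_center, center_val, Matrix.mulVec, dotProduct,
      Fin.sum_univ_three]

/-- The Jacobian of the swap at the centre is the swap. -/
theorem Jac_swapU_center : Jac swapU center = !![0, 1; 1, 0] := by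
  ext i j
  fin_cases i <;> fin_cases j <;>
    simp [Jac, W3, swapU, swapMat, lift_center, Matrix.mulVec, dotProduct, Fin.sum_univ_three]

/-- The Jacobian of the phase at the centre is `diag(1, i)`. -/
theorem Jac_phaseU_center : Jac phaseU center = !![1, 0; 0, Complex.I] := by
  ext i j
  fin_cases i <;> fin_cases j <;>
    simp [Jac, W3, phaseU, phaseMat, lift_center, Matrix.mulVec, dotProduct, Fin.sum_univ_three]

/-! ### The wedge algebra on `ℂ²` -/

/-- `wedge (M x) (M y) = det M · wedge x y`. -/
theorem wedge_mulVec (M : Matrix (Fin 2) (Fin 2) ℂ) (x y : Fin 2 → ℂ) :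
    wedge (M *ᵥ x) (M *ᵥ y) = M.det * wedge x y := by
  simp [wedge, Matrix.mulVec, dotProduct, Fin.sum_univ_two, Matrix.det_fin_two]
  ring

/-- Two covectors whose wedges with a nonzero covector `w` vanish have vanishing wedge. -/
theorem wedge_eq_zero_of_wedge_eq_zero {a b w : Fin 2 → ℂ} (hw : w ≠ 0) (ha : wedge a w = 0)
    (hb : wedge b w = 0) : wedge a b = 0 := by
  unfold wedge at *
  by_cases h0 : w 0 = 0
  · have h1 : w 1 ≠ 0 := by
      intro h1; apply hw; ext i; fin_cases i <;> simp [h0, h1]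
    have : (a 0 * b 1 - a 1 * b 0) * w 1 = 0 := by linear_combination b 1 * ha - a 1 * hb
    exact (mul_eq_zero.mp this).resolve_right h1
  · have : (a 0 * b 1 - a 1 * b 0) * w 0 = 0 := by linear_combination (-a 0) * hb + b 0 * ha
    exact (mul_eq_zero.mp this).resolve_right h0

/-- An invertible matrix does not kill a nonzero vector. -/
theorem mulVec_ne_zero_of_isUnit {M : Matrix (Fin 2) (Fin 2) ℂ} (hM : IsUnit M) {x : Fin 2 → ℂ}
    (hx : x ≠ 0) : M *ᵥ x ≠ 0 := by
  intro h
  apply hx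
  have hdet := (Matrix.isUnit_iff_isUnit_det M).mp hM
  have := congrArg (fun v => M⁻¹ *ᵥ v) h
  simp only [Matrix.mulVec_mulVec, Matrix.nonsing_inv_mul M hdet, Matrix.one_mulVec,
    Matrix.mulVec_zero] at this
  exact this

/-- `i − 1 ≠ 0`. -/
theorem I_sub_one_ne_zero : Complex.I - 1 ≠ 0 := by
  intro h
  have := congrArg Complex.re h
  simp at this

/-! ### The algebraic core of statement (c) -/

/-- **Algebraic core of the Hecke-translate wedge statement.**  For any two cotangent fields
`F, G : 𝔹² → ℂ²` that are not identically zero, some `γ ∈ U(2,1)` and some `z ∈ 𝔹²` have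
`(γ^*F)(z) ∧ G(z) ≠ 0`, where `(γ^*F)(z) = J_γ(z)ᵀ F(γ z)`.

Proof: pick `z₀` with `G z₀ ≠ 0` and `w₀` with `F w₀ ≠ 0`; with the boosts `h = T_{z₀}`,
`g = T_{w₀}` and an isotropy element `k` at the centre, `γ = g k h⁻¹` sends `z₀` to `w₀` and, by the
chain rule, `(γ^*F)(z₀) = Pᵀ J_k(0)ᵀ v` with `P = J_{h⁻¹}(z₀)`, `v = J_g(0)ᵀ F(w₀) ≠ 0`.  If all
these wedges with `G z₀` vanished, the vectors `v`, `(v₁, v₀)`, `(v₀, i v₁)` would be pairwise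
parallel, forcing `v = 0`. -/
theorem exists_wedge_ne_zero (F G : Ball → Fin 2 → ℂ) (hF : ∃ w, F w ≠ 0) (hG : ∃ z, G z ≠ 0) :
    ∃ (γ : U21) (z : Ball), wedge ((Jac γ z)ᵀ *ᵥ F (act γ z)) (G z) ≠ 0 := by
  obtain ⟨w₀, hw₀⟩ := hF
  obtain ⟨z₀, hz₀⟩ := hG
  by_contra hcon
  simp only [not_exists, not_not] at hcon
  set h := boost z₀ with hh
  set g := boost w₀ with hg
  have hinv : act h⁻¹ z₀ = center := by
    conv_lhs => rw [← act_boost_center z₀]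
    exact act_inv_act h center
  have hact : ∀ k : U21, act k center = center → act (g * k * h⁻¹) z₀ = w₀ := by
    intro k hk
    rw [← act_mul, ← act_mul, hinv, hk, act_boost_center]
  have hJac : ∀ k : U21, act k center = center →
      Jac (g * k * h⁻¹) z₀ = Jac g center * Jac k center * Jac h⁻¹ z₀ := by
    intro k hk
    rw [Jac_mul, Jac_mul, hinv, hk]
  set P := Jac h⁻¹ z₀ with hP
  set M := Jac g center with hM
  set v := Mᵀ *ᵥ F w₀ with hv
  have hMt : IsUnit Mᵀ := by
    rw [Matrix.isUnit_iff_isUnit_det, Matrix.det_transpose]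
    exact (Matrix.isUnit_iff_isUnit_det _).mp (isUnit_Jac g center)
  have hv0 : v ≠ 0 := mulVec_ne_zero_of_isUnit hMt hw₀
  have key : ∀ k : U21, act k center = center →
      wedge (Pᵀ *ᵥ ((Jac k center)ᵀ *ᵥ v)) (G z₀) = 0 := by
    intro k hk
    have := hcon (g * k * h⁻¹) z₀
    rw [hact k hk, hJac k hk, Matrix.transpose_mul, Matrix.transpose_mul, ← Matrix.mulVec_mulVec,
      ← Matrix.mulVec_mulVec] at this
    exact this
  have k1 := key 1 (act_one center)
  have k2 := key swapU act_swapU_center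
  have k3 := key phaseU act_phaseU_center
  rw [Jac_one, Matrix.transpose_one, Matrix.one_mulVec] at k1
  rw [Jac_swapU_center] at k2
  rw [Jac_phaseU_center] at k3
  have hdetP : Pᵀ.det ≠ 0 := by rw [Matrix.det_transpose]; exact det_Jac_ne_zero h⁻¹ z₀
  have e12 : v 0 * v 0 - v 1 * v 1 = 0 := by
    have := wedge_eq_zero_of_wedge_eq_zero hz₀ k1 k2
    rw [wedge_mulVec] at this
    have := (mul_eq_zero.mp this).resolve_left hdetP
    simpa [wedge, Matrix.mulVec, dotProduct, Fin.sum_univ_two] using this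
  have e13 : v 0 * (Complex.I * v 1) - v 1 * v 0 = 0 := by
    have := wedge_eq_zero_of_wedge_eq_zero hz₀ k1 k3
    rw [wedge_mulVec] at this
    have := (mul_eq_zero.mp this).resolve_left hdetP
    simpa [wedge, Matrix.mulVec, dotProduct, Fin.sum_univ_two] using this
  have hprod : v 0 * v 1 = 0 := by
    have : (Complex.I - 1) * (v 0 * v 1) = 0 := by linear_combination e13
    exact (mul_eq_zero.mp this).resolve_left I_sub_one_ne_zero
  apply hv0
  rcases mul_eq_zero.mp hprod with h0 | h1
  · have h1 : v 1 = 0 := by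
      have : v 1 * v 1 = 0 := by linear_combination -e12 + v 0 * h0
      exact mul_self_eq_zero.mp this
    ext i; fin_cases i <;> simp [h0, h1]
  · have h0 : v 0 = 0 := by
      have : v 0 * v 0 = 0 := by linear_combination e12 + v 1 * h1
      exact mul_self_eq_zero.mp this
    ext i; fin_cases i <;> simp [h0, h1]

end BallCore

end Summit.Ventures.HodgeRepro

end
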